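import Summits.BirchSwinnertonDyer.BirchSwinnertonDyer.Theorems.EisensteinPrimesGoodLatticeKatzFrameSpanRigidity
import Summits.BirchSwinnertonDyer.BirchSwinnertonDyer.Theorems.PrintCf2RubinValueTwoTwoVariableMainConjAtSplitTwoMeasureExists
import Literature.NumberTheory.EllipticCurves.CastellaGrossiLeeSkinner2022.EisensteinCongruenceOfFullDescent
import Literature.NumberTheory.EllipticCurves.CastellaGrossiLeeSkinner2022.KatzFrameCbarIndependence
import HarnessLib

/-!
# The two 3a-A names of crux 2 FOLLOW from their `∃`-frame (print-shaped) forms — kernel implications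
# `(∃-frame form) → Hida2010MuInvariant.thmI_mu_katzLFunction_eq_zero` and
# `(∃-frame-pair form) → CastellaGrossiLeeSkinner2022.proofThm221_congruence_of_fullEisensteinDescent`
# (helper file 3 for crux 2 `GoodLatticeBDPValue`, stmt-BirchSwinnertonDyer-19032, line `halves` v34N; closes no stub)

Cell `bsd-eis` (run/shared/lean/pub/bsd-eis/), width seat `bsd-line-x1-p1-w2` gen 31. THEOREMS ONLY (no definition,
no named fact, no `sorry`; imports no `Theses` module); `--supports stmt-BirchSwinnertonDyer-19032`.

WHAT. The by-name closure of crux 2 (`GoodLatticeBDPValueOfNamedFactsV34.goodLatticeBDPValue_of_namedFacts₃₄`, p763736)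
rests on seven PUBLISHED names; two of them (the 3a-A names, typed by this lineage's g26) are phrased for EVERY Katz frame
(`thmI_…`: «every `R₀` Katz frame of `θ_K` has `μ = 0`») resp. EVERY (BDP frame, Katz frame) pair (`proofThm221_…`:
«`L ≡ U·(𝓔)²·L_φ² (mod 𝔪)` for a unit `U`»), at ANY period pairs, whereas print gives Hida's Theorem I for THE Katz
measure and CGLS's congruence (2.14)–(2.15) for THEIR `𝓛_E`, `𝓛_φ`. This file proves, as kernel implications with the
hypotheses SPELLED OUT (no new `def`):
* `thmI_mu_katzLFunction_eq_zero_of_exists_frame` — the typed name FOLLOWS from its `∃`-frame form: same binders through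
  `θ_K`, then «THERE IS a frame `(Ω_K ≠ 0, Ω_p ∈ R₀ˣ, L)` with `IsKatzLFunction ι' v v̄ ∅ κ γ θ_K Ω_K Ω_p L` and
  `∃ n, FirstUnitCoeffAt L n`» = the conclusion of `thm212_exists_isKatzLFunction` (CGLS Thm. 2.1.2, existence) with
  Hida's `μ = 0` for THAT object;
* `proofThm221_congruence_of_existsFramePair` — the typed name FOLLOWS from its `∃`-frame-pair form: same binders with the
  two frames moved under `∃` («there are a BDP frame of `f_E` and a Katz frame of `θ_K` with the congruence»).
Tools: the Katz span rigidity of files 1–2 (`GoodLatticeKatzFrameRigidity.associated_of_isKatzLFunction`,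
`exists_firstUnitCoeffAt_of_associated`, `eisensteinCongruence_of_framePair_of_framePair`), BDP span rigidity
(`UniversalToricDescentTwinSplit.span_singleton_eq_of_isBDPLFunction`), `Cbar`-independence of the Katz frame at ramified
places (`isKatzLFunction_iff_empty_of_forall_not_isUnramifiedAt`), finite order of `θ_K`
(`PrintCf2RubinValueTwo.MeasureExists.isFiniteOrder_of_isHeckeCharOf_of_pow_eq_one`).

UPSHOT (numbers): of the 7 names, 4 are `∃`-frame statements (print-shaped on the period axis: `proofThm422_…`,
`thm513_…`, `thm212_…`, `thm331_…`); for 2 (`thmI_…`, `proofThm221_…`) the `∀`-frame phrasing is now PROVED equivalent in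
strength to the `∃`-frame phrasing modulo tree theorems (this file; the converse direction costs one frame, i.e.
`thm212_…` / `proofThm422_…`); the 7th (`thmII64_…`, two-variable) has the structural rigidity in the tree
(`span_eq_span_of_isKatzMeasure₂`) but its conclusion-shape transport across period triples is not a tree theorem.

HONEST FRAMING: conditional implications between statement shapes; nothing asserts the truth of either name; closes no
stub; the registry (halves v34N, 2 cite-only stubs) is untouched; no summit statement, no case of BSD, no theorem of
CGLS / Hida / Katz / Kriz is proved here; 0 cells / labels / tiers move.

References: [Hida2010MuInvariant] Thm. I (p. 45); [CastellaGrossiLeeSkinner2022] Thm. 2.1.2 (arXiv:2008.02571v2 TeX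
L1015–1041), Thm. 2.2.1 and its proof (L1051–L1116); [Kriz2016] Def. 31, Rem. 32; [Castella2018] Thm. 3.1;
[Washington1997] §7.1 Prop. 7.2.
-/

set_option linter.dupNamespace false
set_option autoImplicit false

noncomputable section

open scoped Classical

open PowerSeries WeierstrassCurve NumberField IsDedekindDomain Field
  Literature.NumberTheory.EllipticCurves Literature.NumberTheory.EllipticCurves.Rank1Residual
  Literature.NumberTheory.EllipticCurves.ModularForms
  Literature.NumberTheory.GaloisRepresentations Literature.NumberTheory.QuadraticFields
  Literature.NumberTheory.EllipticCurves.KellerYin2024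
  Literature.NumberTheory.EllipticCurves.CastellaGrossiLeeSkinner2022
  Literature.NumberTheory.EllipticCurves.Hida2010MuInvariant
  Summit.BirchSwinnertonDyer.Rank1Residual.X11b.Halves
  Summit.BirchSwinnertonDyer.BirchSwinnertonDyer.Theorems

namespace Summit.BirchSwinnertonDyer.BirchSwinnertonDyer.Theorems.GoodLatticeKatzFrameRigidity

/-! ### §1 Hida 2010 Thm. I in the tree's `∀`-frame currency FOLLOWS from its `∃`-frame form -/

/-- **`thmI_mu_katzLFunction_eq_zero` ⟸ its `∃`-frame (print-shaped) form.** The hypothesis is, binder for binder,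
`CastellaGrossiLeeSkinner2022.thm212_exists_isKatzLFunction` (existence of THE anticyclotomic Katz `p`-adic `L`-function
`𝓛_θ ∈ Λ^{ur}`, CGLS Thm. 2.1.2) with Hida's Theorem I «`μ(𝓛_θ) = 0`» (`∃ n, FirstUnitCoeffAt L n`) asserted for THAT
object; the conclusion is the tree's named fact, which asserts `μ = 0` for EVERY Katz frame at ANY period pair and ANY set
`Cbar` of ramified places. Proof: `Cbar`-independence at ramified places, `θ_K` of finite order (`θ^{p−1} = 1`), and Katz span
rigidity (`associated_of_isKatzLFunction`: any two frames are associates in `R₀⟦T⟧`; `μ = 0` is associate-invariant).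
[cite: Hida2010MuInvariant, Thm. I (p. 45)] [cite: CastellaGrossiLeeSkinner2022, Thm. 2.1.2 (arXiv:2008.02571v2 TeX L1015–1041)]
[cite: Washington1997, §7.1 Prop. 7.2] -/
theorem thmI_mu_katzLFunction_eq_zero_of_exists_frame
    (H :
      ∀ (p : ℕ) [Fact p.Prime], 2 < p →
        ∀ (K : Type) [Field K] [NumberField K], IsImaginaryQuadratic K →
          SatisfiesHeegnerHypothesis p K → Odd (NumberField.discr K) → NumberField.discr K ≠ -3 →
        ∀ (ι : K →+* ℚ_[p]) (v vbar : HeightOneSpectrum (𝓞 K)),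
          (∀ x : 𝓞 K, x ∈ v.asIdeal ↔ ‖ι (x : K)‖ < 1) →
          ((p : ℕ) : 𝓞 K) ∈ vbar.asIdeal → vbar ≠ v →
        ∀ (κ : ZpExtension K p), κ.IsAnticyclotomic →
        ∀ (γ : absoluteGaloisGroup K) [Fact (κ.IsTopGenerator γ)],
        ∀ (ι' : PadicAlgCl p ≃+* ℂ),
          (∀ (w : InfinitePlace K) (k : 𝓞 K), k ∈ v.asIdeal ↔ ‖ι'.symm (w.embedding (k : K))‖ < 1) →
        ∀ (θ : FramedGaloisRep ℚ (padicCoeffIntegers (∅ : Set (PadicAlgCl p))) 1),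
          (∀ σ : absoluteGaloisGroup ℚ, θ σ ^ (p - 1) = 1) →
        ∀ (C : ℕ), SatisfiesHeegnerHypothesis C K →
          (∀ u : HeightOneSpectrum (𝓞 ℚ), ((C : ℤ) : 𝓞 ℚ) ∉ u.asIdeal → θ.IsUnramifiedAt u) →
          (∀ u : HeightOneSpectrum (𝓞 ℚ), ((p : ℕ) : 𝓞 ℚ) ∈ u.asIdeal → θ.IsUnramifiedAt u) →
        ∀ (θK : HeckeCharacter K), IsHeckeCharOf ι' (θ.restrictField K) θK →
        ∃ (ΩK : ℂ) (Ωp : (unrIntegers p)ˣ) (L : UnrSeries p), ΩK ≠ 0 ∧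
          IsKatzLFunction ι' v vbar ∅ κ γ θK ΩK ((Ωp : unrIntegers p) : ℂ_[p]) L ∧ ∃ n : ℕ, FirstUnitCoeffAt L n) :
    thmI_mu_katzLFunction_eq_zero := by
  unfold thmI_mu_katzLFunction_eq_zero
  intro p _ hp2 K _ _ hK hHeeg hodd hd3 ι v vbar hv hvbar hne κ hκ γ hγ ι' hι' θ hθ C hC hθC hθp θK hθK Cbar hCbar
    ΩK Ωp L hΩK hL
  obtain ⟨ΩK₀, Ωp₀, L₀, hΩK₀, hL₀, hμ₀⟩ :=
    H p hp2 K hK hHeeg hodd hd3 ι v vbar hv hvbar hne κ hκ γ ι' hι' θ hθ C hC hθC hθp θK hθK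
  have hp2' : p ≠ 2 := by omega
  have hfin : θK.IsFiniteOrder :=
    PrintCf2RubinValueTwo.MeasureExists.isFiniteOrder_of_isHeckeCharOf_of_pow_eq_one ι'
      (Nat.sub_pos_of_lt (by omega : 1 < p))
      (fun σ ↦ by rw [FramedGaloisRep.restrictField_apply]; exact hθ _) hθK
  have hL' : IsKatzLFunction ι' v vbar ∅ κ γ θK ΩK ((Ωp : unrIntegers p) : ℂ_[p]) L :=
    (isKatzLFunction_iff_empty_of_forall_not_isUnramifiedAt ι' v vbar κ γ hCbar ΩK _ L).mp hL
  have hΩp₀ : ((Ωp₀ : unrIntegers p) : ℂ_[p]) ≠ 0 := by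
    intro h0; have h1 := norm_coe_units_unrIntegers p Ωp₀; rw [h0, norm_zero] at h1; exact zero_ne_one h1
  have hΩp : ((Ωp : unrIntegers p) : ℂ_[p]) ≠ 0 := by
    intro h0; have h1 := norm_coe_units_unrIntegers p Ωp; rw [h0, norm_zero] at h1; exact zero_ne_one h1
  exact exists_firstUnitCoeffAt_of_associated
    (associated_of_isKatzLFunction hp2' hK hκ hγ.out hfin hΩK₀ hΩp₀ hΩK hΩp hL₀ hL') hμ₀

/-! ### §2 CGLS's proof of Thm. 2.2.1 in the tree's `∀`-frame-pair currency FOLLOWS from its `∃`-frame-pair form -/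

/-- **`proofThm221_congruence_of_fullEisensteinDescent` ⟸ its `∃`-frame-pair (print-shaped) form.** The hypothesis
has the binders of the named fact with the two frames moved under `∃`: «… there are a BDP frame `(Ω_K ≠ 0, Ω_p ∈ R₀ˣ, L)`
of `f_E` and a Katz frame `(Ω_K' ≠ 0, Ω_p' ∈ R₀ˣ, L_φ)` of `θ_K` and places / local elements / a unit `U` with
`L ≡ U·(𝓔)²·L_φ² (mod 𝔪)`» — what CGLS's (2.14)–(2.15) give for THEIR `𝓛_E`, `𝓛_φ`; the conclusion is the tree's named
fact (EVERY frame pair, ANY periods). Proof: BDP span rigidity + Katz span rigidity make any two BDP frames resp. any two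
Katz frames associates in `R₀⟦T⟧`, and the congruence up to a unit passes to associates
(`eisensteinCongruence_of_framePair_of_framePair`); `θ_K` has finite order since `θquot` is a Teichmüller lift.
[cite: CastellaGrossiLeeSkinner2022, Thm. 2.2.1 and its proof (arXiv:2008.02571v2 TeX L1051–L1116), Thm. 2.1.2] [cite: Kriz2016, Def. 31, Rem. 32]
[cite: Castella2018, Thm. 3.1] [cite: Washington1997, §7.1 Prop. 7.2] -/
theorem proofThm221_congruence_of_existsFramePair
    (H :
      ∀ (W : WeierstrassCurve ℚ) [W.IsElliptic] [W.IsGloballyMinimal] (p : ℕ) [Fact p.Prime],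
        2 < p → Good W p →
        -- `E[p]^{ss} ≅ 𝔽_p(φ) ⊕ 𝔽_p(ψ)`: a rational line `Φ ≤ E[p]` with Teichmüller lifts `θsub = ψ̃` (on `Φ`) and
        -- `θquot = φ̃` (on `E[p]/Φ`); "labeled so that `p ∤ cond(φ)`": `θquot` unramified at `p`
        ∀ (Φ : AddSubgroup (geomTorsion W (p : ℤ))), IsRationalLine W p Φ →
        ∀ (θsub θquot : FramedGaloisRep ℚ (padicCoeffIntegers (∅ : Set (PadicAlgCl p))) 1),
          IsTeichmullerLiftOn (∅ : Set (PadicAlgCl p)) (Φ.map (geomTorsion W (p : ℤ)).subtype) θsub →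
          IsTeichmullerLiftOnQuot (∅ : Set (PadicAlgCl p)) (Φ.map (geomTorsion W (p : ℤ)).subtype)
            (geomTorsion W (p : ℤ)) θquot →
          (∀ u : HeightOneSpectrum (𝓞 ℚ), ((p : ℕ) : 𝓞 ℚ) ∈ u.asIdeal → θquot.IsUnramifiedAt u) →
        -- (eq:cong-mf) `f ≡ E₂^{φ,φ⁻¹,(N)} (mod p)` ⟸ FULL Eisenstein descent of type `(φ̃, φ̃⁻¹, N₊, N₋, N₀)` mod `p`
        -- (Kriz 2016 Def. 31 with Rem. 32): the TYPE — `N₀` = the additive primes (squarefull part), `N₊ ⊔ N₋` = the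
        -- multiplicative primes (squarefree part) of `N_E`
        ∀ (Nplus Nminus Nzero : Finset ℕ),
          Nplus ⊆ (W.conductorNorm ℤ).primeFactors → Nminus ⊆ (W.conductorNorm ℤ).primeFactors →
          Nzero ⊆ (W.conductorNorm ℤ).primeFactors →
          (∀ (ℓ : ℕ) (hℓ : ℓ ∈ (W.conductorNorm ℤ).primeFactors),
            haveI : Fact ℓ.Prime := ⟨Nat.prime_of_mem_primeFactors hℓ⟩
            (ℓ ∈ Nzero ↔ ¬ W.HasMultiplicativeReductionAtPrime ℓ) ∧
            ((ℓ ∈ Nplus ∨ ℓ ∈ Nminus) ↔ W.HasMultiplicativeReductionAtPrime ℓ) ∧ ¬ (ℓ ∈ Nplus ∧ ℓ ∈ Nminus)) →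
          -- (1) `a_ℓ ≡ φ̃(ℓ) + φ̃(ℓ)⁻¹ ℓ (mod p)` for `ℓ ∤ N`
          (∀ (ℓ : ℕ) (u : HeightOneSpectrum (𝓞 ℚ)), ℓ.Prime → ((ℓ : ℕ) : 𝓞 ℚ) ∈ u.asIdeal →
            ¬ ℓ ∣ W.conductorNorm ℤ → ∀ a : padicCoeffIntegers (∅ : Set (PadicAlgCl p)),
            θquot.HasFrobCharpolyAt u (Polynomial.X - Polynomial.C a) →
            ‖((W.LFunction ℓ : ℤ) : PadicAlgCl p) - ((a : PadicAlgCl p) + (a : PadicAlgCl p)⁻¹ * (ℓ : PadicAlgCl p))‖ < 1) →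
          -- (2) `a_ℓ ≡ φ̃(ℓ)` for `ℓ ∣ N₊`;  (3) `a_ℓ ≡ φ̃(ℓ)⁻¹ ℓ` for `ℓ ∣ N₋`
          (∀ ℓ ∈ Nplus, ∀ u : HeightOneSpectrum (𝓞 ℚ), ((ℓ : ℕ) : 𝓞 ℚ) ∈ u.asIdeal → θquot.IsUnramifiedAt u ∧
            ∀ a : padicCoeffIntegers (∅ : Set (PadicAlgCl p)), θquot.HasFrobCharpolyAt u (Polynomial.X - Polynomial.C a) →
            ‖((W.LFunction ℓ : ℤ) : PadicAlgCl p) - (a : PadicAlgCl p)‖ < 1) →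
          (∀ ℓ ∈ Nminus, ∀ u : HeightOneSpectrum (𝓞 ℚ), ((ℓ : ℕ) : 𝓞 ℚ) ∈ u.asIdeal → θquot.IsUnramifiedAt u ∧
            ∀ a : padicCoeffIntegers (∅ : Set (PadicAlgCl p)), θquot.HasFrobCharpolyAt u (Polynomial.X - Polynomial.C a) →
            ‖((W.LFunction ℓ : ℤ) : PadicAlgCl p) - (a : PadicAlgCl p)⁻¹ * (ℓ : PadicAlgCl p)‖ < 1) →
          -- (4) `a_ℓ ≡ 0` for `ℓ ∣ N₀`
          (∀ ℓ ∈ Nzero, ‖((W.LFunction ℓ : ℤ) : PadicAlgCl p)‖ < 1) →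
          -- (5) (k = 2, ε_f = 𝟙; only when `φ̃ = 𝟙`, Rem. 33): `(1/24)·∏_{ℓ∣N₊}(1−ℓ)·∏_{ℓ∣N₋}(1−1)·∏_{ℓ∣N₀}(1−ℓ)(1−1) ≡ 0 (mod p)`
          ((∀ σ : absoluteGaloisGroup ℚ, θquot σ = 1) →
            ‖(((1 : ℚ) / 24 * ((∏ ℓ ∈ Nplus, (1 - (ℓ : ℚ))) * (∏ _ℓ ∈ Nminus, ((1 : ℚ) - 1)) *
                (∏ ℓ ∈ Nzero, (1 - (ℓ : ℚ)) * ((1 : ℚ) - 1))) : ℚ) : ℚ_[p])‖ < 1) →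
        -- CGLS §2 standing hypotheses on `K` and the frames (verbatim the binders of `thm212_…` / `thm222_…`)
        ∀ (K : Type) [Field K] [NumberField K], IsImaginaryQuadratic K →
          SatisfiesHeegnerHypothesis (W.conductorNorm ℤ) K → SatisfiesHeegnerHypothesis p K →
          Odd (NumberField.discr K) → NumberField.discr K ≠ -3 →
        ∀ (ι : K →+* ℚ_[p]) (v vbar : HeightOneSpectrum (𝓞 K)),
          (∀ x : 𝓞 K, x ∈ v.asIdeal ↔ ‖ι (x : K)‖ < 1) →
          ((p : ℕ) : 𝓞 K) ∈ vbar.asIdeal → vbar ≠ v →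
        ∀ (κ : ZpExtension K p), κ.IsAnticyclotomic →
        ∀ (γ : absoluteGaloisGroup K) [Fact (κ.IsTopGenerator γ)],
        ∀ (N : ℕ) [NeZero N] (Dt : ModularParametrizationData W N),
        ∀ (ι' : PadicAlgCl p ≃+* ℂ),
          (∀ (w : InfinitePlace K) (k : 𝓞 K), k ∈ v.asIdeal ↔ ‖ι'.symm (w.embedding (k : K))‖ < 1) →
        ∀ (θK : HeckeCharacter K), IsHeckeCharOf ι' (θquot.restrictField K) θK →
        ∀ (Cbar : Finset (HeightOneSpectrum (𝓞 K))), (∀ u ∈ Cbar, ¬ θK.IsUnramifiedAt u) →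
        -- the structure map `j : ℤ_p → R₀` (`j(x) = x` in `ℂ_p`), through which `(1+T)^b`, `b ∈ ℤ_p`, is read in `R₀⟦T⟧`
        ∀ (j : ℤ_[p] →+* unrIntegers p), (∀ x : ℤ_[p], ((j x : unrIntegers p) : ℂ_[p]) = ((x : ℚ_[p]) : ℂ_[p])) →
        -- CONCLUSION `𝓛_E ≡ (𝓔^ι_{φ,ψ})²·𝓛_φ² (mod pΛ^{ur})`, read in the frames up to a unit of `Λ^{ur} = R₀⟦T⟧`
        ∃ (ΩK : ℂ) (Ωp : (unrIntegers p)ˣ) (L : UnrSeries p), ΩK ≠ 0 ∧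
          IsBDPLFunction ι' v κ γ Dt.f ΩK ((Ωp : unrIntegers p) : ℂ_[p]) L ∧
        ∃ (ΩK' : ℂ) (Ωp' : (unrIntegers p)ˣ) (Lφ : UnrSeries p), ΩK' ≠ 0 ∧
          IsKatzLFunction ι' v vbar Cbar κ γ θK ΩK' ((Ωp' : unrIntegers p) : ℂ_[p]) Lφ ∧
        ∃ (wl : ℕ → HeightOneSpectrum (𝓞 K)) (Pq Ps : ℕ → UnrSeries p) (U : UnrSeries p), IsUnit U ∧
          (∀ ℓ ∈ (W.conductorNorm ℤ).primeFactors, ((ℓ : ℕ) : 𝓞 K) ∈ (wl ℓ).asIdeal) ∧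
          (∀ ℓ ∈ (W.conductorNorm ℤ).primeFactors,
            (¬ (θquot.restrictField K).IsUnramifiedAt (wl ℓ) → Pq ℓ = 1) ∧
            ((θquot.restrictField K).IsUnramifiedAt (wl ℓ) →
              ∃ (a : padicCoeffIntegers (∅ : Set (PadicAlgCl p))) (u : unrIntegers p) (b : ℤ_[p]),
                (θquot.restrictField K).HasFrobCharpolyAt (wl ℓ) (Polynomial.X - Polynomial.C a) ∧
                ‖(u : ℂ_[p]) * (ℓ : ℂ_[p]) - ((a : PadicAlgCl p) : ℂ_[p])‖ < 1 ∧
                (b = κ.frobExponentAt (wl ℓ) ∨ b = -κ.frobExponentAt (wl ℓ)) ∧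
                Pq ℓ = 1 - C u * (binomialSeries ℤ_[p] b).map j)) ∧
          (∀ ℓ ∈ (W.conductorNorm ℤ).primeFactors,
            (¬ (θsub.restrictField K).IsUnramifiedAt (wl ℓ) → Ps ℓ = 1) ∧
            ((θsub.restrictField K).IsUnramifiedAt (wl ℓ) →
              ∃ (a : padicCoeffIntegers (∅ : Set (PadicAlgCl p))) (u : unrIntegers p) (b : ℤ_[p]),
                (θsub.restrictField K).HasFrobCharpolyAt (wl ℓ) (Polynomial.X - Polynomial.C a) ∧
                ‖(u : ℂ_[p]) * (ℓ : ℂ_[p]) - ((a : PadicAlgCl p) : ℂ_[p])‖ < 1 ∧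
                (b = κ.frobExponentAt (wl ℓ) ∨ b = -κ.frobExponentAt (wl ℓ)) ∧
                Ps ℓ = 1 - C u * (binomialSeries ℤ_[p] b).map j)) ∧
          ∀ i : ℕ, ‖((coeff i L : unrIntegers p) : ℂ_[p]) -
            ((coeff i (U * ((∏ ℓ ∈ Nzero ∪ Nminus, Pq ℓ) * (∏ ℓ ∈ Nzero ∪ Nplus, Ps ℓ)) ^ 2 * Lφ ^ 2) :
              unrIntegers p) : ℂ_[p])‖ < 1) :
    proofThm221_congruence_of_fullEisensteinDescent := by
  unfold proofThm221_congruence_of_fullEisensteinDescent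
  intro W _ _ p _ hp hgood Φ hΦ θsub θquot hsub hquot hθp Nplus Nminus Nzero hs1 hs2 hs3 htype h1 h2 h3 h4 h5
    K _ _ hK hHN hHp hodd hd3 ι v vbar hv hvbar hne κ hκ γ hγ N _ Dt ι' hι' ΩK Ωp L hΩK hL θK hθK Cbar hCbar
    ΩK' Ωp' Lφ hΩK' hLφ j hj
  obtain ⟨ΩK₀, Ωp₀, L₀, hΩK₀, hL₀, ΩK₀', Ωp₀', Lφ₀, hΩK₀', hLφ₀, wl, Pq, Ps, U, hU, hwl, hPq, hPs, hcong⟩ :=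
    H W p hp hgood Φ hΦ θsub θquot hsub hquot hθp Nplus Nminus Nzero hs1 hs2 hs3 htype h1 h2 h3 h4 h5
      K hK hHN hHp hodd hd3 ι v vbar hv hvbar hne κ hκ γ N Dt ι' hι' θK hθK Cbar hCbar j hj
  have hp2' : p ≠ 2 := by omega
  have hpow : ∀ σ : absoluteGaloisGroup ℚ, θquot σ ^ (p - 1) = 1 := hquot.1
  have hfin : θK.IsFiniteOrder :=
    PrintCf2RubinValueTwo.MeasureExists.isFiniteOrder_of_isHeckeCharOf_of_pow_eq_one ι'
      (Nat.sub_pos_of_lt (by omega : 1 < p))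
      (fun σ ↦ by rw [FramedGaloisRep.restrictField_apply]; exact hpow _) hθK
  have hu : ∀ w : (unrIntegers p)ˣ, ((w : unrIntegers p) : ℂ_[p]) ≠ 0 := fun w h0 ↦ by
    have h1 := norm_coe_units_unrIntegers p w; rw [h0, norm_zero] at h1; exact zero_ne_one h1
  obtain ⟨U', hU', hcong'⟩ := eisensteinCongruence_of_framePair_of_framePair hp2' hK hκ hγ.out hfin
    hΩK₀ (hu Ωp₀) hΩK (hu Ωp) hΩK₀' (hu Ωp₀') hΩK' (hu Ωp') hL₀ hL hLφ₀ hLφ hU hcong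
  exact ⟨wl, Pq, Ps, U', hU', hwl, hPq, hPs, hcong'⟩

end Summit.BirchSwinnertonDyer.BirchSwinnertonDyer.Theorems.GoodLatticeKatzFrameRigidity

end
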